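/-
Copyright: statement-level skeleton of a published paper (lit-balaban cell, Phase-2 proof seat p37 gen 90). No claims beyond
what the kernel checks below.
-/
import Mathlib
import Literature.MathematicalPhysics.QuantumFieldTheory.Balaban1983to89.B3Eq332Pictures
import Literature.MathematicalPhysics.QuantumFieldTheory.Balaban1983to89.B3Eq317Pictures

/-!
# B3 — T. Bałaban, *(Higgs)₂,₃ quantum fields in a finite volume. III. Renormalization*, CMP **88** (1983) 411–445
[Balaban1983Higgs3] — p. 442 [PDF 32]: the PICTURE EQUATION **(3.30)** (the graphical form of the Taylor rearrangement **(3.26)**,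
p. 440, of the four lowest-order vector self-energy graphs **(3.25)**, p. 439) AS DRAWN OBJECTS of the concrete graph model
(`B3Cor23Concrete.Graph`, line kinds visible; p26's `B3Eq37Pictures.LocPicture`, this seat's `B3Eq332Pictures.VBlob`/`HolderPicture`),
the COUNT DATA of the drawn objects (derived), and the DICTIONARY from ALL FOUR drawn pictures (3.25) to the four terms T₁, …, T₄ of
the left side of r15's (3.26) `B3Sect3VectorSelfEnergy.lhs326` and from the four right-hand pictures of (3.30) to the three brackets of
r15's PROVED `eq326` (square bracket = the vertex ∿∗∿, first curly bracket = the vertex ∿∗→∿, last curly bracket = the two decorated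
pictures) — the fold owner's pre-audit points (1) + (2) for row B3.Eq3.25-3.32

statement-level skeleton of published theorems with citation tags; proofs where landed; nothing here is a claim about
the Yang–Mills mass gap

PDF held: `paper:balaban1983-higgs-2-3-quantum-fields-finite-volume` (journal page = PDF page + 410); pp. 417, 439, 440, 442
[PDF 7, 29, 30, 32] read in the OCR text (`p0030.txt`–`p0032.txt`) and on the ×2 renders
`run/shared/lean/pub/pub-balaban/b2b-balaban-ref1/pages/1983-cmp88-higgs23-III/1983-cmp88-higgs23-III-p029-x2.png`, `…-p032-x2.png` (the
pictures (3.25) and (3.30), re-read by this seat 2026-08-23).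

CITATION HEADER (lean-in-tree rule).  lit-balaban TYPED SKELETON (HOME `run/shared/lean/pub/lit-balaban/`), PHASE 2, seat p37 gen 90
(unit `lit-balaban-p37-g90`; TAKING line HOME/STATUS.md 2026-08-23T03:06:59Z), target NAMED BY THE FOLD OWNER r15 g14 (seat INBOX
2026-08-23T02:44:05Z, the owner's PRE-AUDIT of row B3.Eq3.25-3.32, verbatim): *"(1) (3.30) p. 442 AS DRAWN OBJECTS — the picture
EQUATION «∿◯∿ + ∿◯∿ + ∿Ô∿ + ∿Ô∿ = ∿(◯+(1+α))∿^{−(1+α)}→ + ∿(◯+(1+α))∿^{−(1+α)}→ + ∿∗→∿ + ∿∗∿∿» (LHS = the four (3.25) pictures p18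
`g325a–d`; RHS = two (1+α)-Hölder-decorated pictures with a DERIVATIVE-decorated external leg (∂^η_ν g′A′_{μ′}) + the two local vertices
∿∗→∿ (Π_{μμ′ν}-vertex, one derivative on a leg) and ∿∗∿ (Π_{μμ′}-vertex)) … (2) the (3.25) ↔ (3.26)-LHS amplitude dictionary for ALL
FOUR pictures"*.  ROW **B3.Eq3.25-3.32** of `HOME/lit-balaban-r15/ROWS-B3.md` (fold owner r15, referee ref-4).  CONSUMES BY NAME: this
seat's `B3Eq332Pictures` (`VBlob`, `VBlob.blob`/`vertex`/`holder`/`redKernel`/`sum_pair`, `HolderPicture`, `HolderPicture.deg`, `ampV`,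
`ampV_blob`, `ampV_vertex`, `kernelV2`, `blob325a`, `redKernel_blob325a`, `amp_g325a_T1`), p26 gen 33's `B3Eq37Pictures` (`LocPicture`,
`LocPicture.natural`, `kind36`, `sLeg`, `vLeg`, `legDiffs`, `legAvg`, `legDiffs36`, `LineEnum`, `countsOf`), p18 gen 3's drawn graphs
`B3Sect3LowestOrderGraphs.g325a/b/c/d` (`g325b_deg`, `g325c_deg`, `g325d_deg`; p248264), p26 gen 28's count data
`B3Eq330Members.δ325b`/`graph325c`/`graph325d` (`graph325b_eq_graph38`), r15's (3.26) carrier `B3Sect3VectorSelfEnergy` (`pairSum`,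
`legFar`, `legNear`, `kerA`, `kerB`, `kerC`, `term3`, `term4`, `lhs326`, `bracket326`, `curly1`, `curly2`, `Pi2`, `Pi3`, `dAdjKernel`,
`pairSum_kerC`, `pairSum_sum_leg`, `bracket326_eq_Pi2`, `curly1_eq_Pi3`, **`eq326`**).

THE PRINTED TEXT (verbatim).  p. 439 [PDF 29]: *"The next class of graphs is the class of self-energy graphs for vector fields. The
graphs of lowest order are [four pictures] (D = −d + 2), (3.25) and they form a renormalized class of graphs connected by
Ward-Takahashi identities (2.26) and (2.27). Let us analyze in detail the expressions corresponding to these graphs."*; p. 440 [PDF 30],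
(3.26) (in full in the module docstring of `B3Sect3VectorSelfEnergy`): left side −T₁ + T₂ − T₃ − T₄, right side −[square bracket] +
{first curly bracket} + {last curly bracket}, *"where A, A′ are external vector field legs. The expressions in the last curly bracket
above are the generalized expressions of the same form as in (3.11), they have positive degree −d+3+α and can be analyzed as in (3.13),
(3.14), and Proposition 2.2 can be applied"*; p. 442 [PDF 32]: *"Let us write the effect of the above transformations in the
following graphical form [∿◯∿] + [∿◯∿] + [∿Ô∿] + [∿Ô∿] = [∿(◯ +(1+α))∿ −(1+α)→] + [∿(◯ +(1+α))∿ −(1+α)→] + [∿∗→∿] + [∿∗∿] (3.30) where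
the coefficient at the vertex ∿∗→∿ is bounded, and the coefficient at the vertex ∿∗∿ is proportional to (L^{j₀}η)^{−d+2}, and j₀
is the lowest j-index of the external legs."*; p. 417 [PDF 7]: *"δm²_G … will be represented by the same graph G but with both
external legs localized in x and with the summation over x′."*; p. 415 legend (1.17): straight line = φ′, wavy line = A′, arrowhead
= differentiation.
READING OF THE PICTURES (pp. 439/442 renders).  LHS of (3.30) = the four pictures of (3.25): (3.25)₁ two vertices joined by two
straight lines each arrowed once, at opposite vertices (p18's `g325a`; kernel T₁: (G∂^{η*}_{μ′})(x,x′)(G∂^{η*}_μ)(x′,x) = r15's `kerA`),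
(3.25)₂ two vertices joined by a doubly arrowed straight line and a plain one (`g325b`; T₂: G(x,x′)(∂^η_{μ′}G∂^{η*}_μ)(x′,x) = `kerB`),
(3.25)₃ the plain straight loop at one vertex (`g325c`, (1.10)_{2,0}; T₃ = `term3`: tr q² G(x,x)), (3.25)₄ the straight loop through
the arrowed leg (`g325d`, (1.8)_{2,0}; T₄ = `term4`: tr q² η(G∂^{η*}_μ)(x,x)), each with its two wavy external legs; RHS₁,₂ = (3.25)₁,₂
inscribed "+(1+α)" with the arrowhead and "−(1+α)" on the second wavy leg (the weight |x′−x|^{1+α} on the kernel, the leg reading the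
order-1 Taylor remainder of g′A′_{μ′} divided by it — r15's `curly2`); RHS₃ = ∿∗→∿, the local two-wavy-leg vertex one of whose legs
is arrowed (the leg (∂^η_νg′A′_{μ′})(x), coefficient Π_{μμ′ν}(x) = r15's `Pi3` — the first curly bracket `curly1`); RHS₄ = ∿∗∿, the
local two-wavy-leg vertex (coefficient Π_{μμ′}(x) = r15's `Pi2` — the square bracket `bracket326`, which collects the four graphs
with BOTH wavy legs localized in x, p. 417, the tadpoles being local already).

WHAT IS TYPED / PROVED (definitions with bodies + theorems; no `Prop` fact, no `sorry`; standard axioms).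
§1 DRAWN OBJECTS.  Closed forms `other325b` (on p26's `kind36`), `kind325c`/`cLeg`/`cwLeg`/`other325c`, `kind325d`/`dLeg`/`dwLeg`/
`other325d` (p18's `g325b/c/d.other` definitionally: `g325b_other`, `g325c_other`, `g325d_other`); LINE KINDS DECIDED: `g325b_lines`
(leg j of x to leg j of x′: the line `0` through BOTH arrowed legs, the line `1` plain; wavy legs external, `other325b_eq_none_iff`),
`g325c_lines`/`g325d_lines` (the straight loop; wavy legs external), arrowheads `legDiffs_325` (`g325d`'s loop passes the arrowed
leg, `g325c` has none); **`blob325b : VBlob`**; the tadpole pictures **`pic325c`**, **`pic325d`** (one vertex: natural = localized,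
`pic325cd_loc`); **`TaylorPicture`** (a `HolderPicture` + the Taylor ORDER carried by the decorated leg = its drawn
arrowheads: order 1 in (3.12)/(3.22)/(3.30), order 0 in (3.20)/(3.32)); **`dec330a`**, **`dec330b`** (RHS₁,₂: `(blob325a/b).holder (1+α)`
with order 1; `dec330_data`: blob label 1+α, leg label −(1+α), one arrowhead); **`pic330`** (the record: the four LHS pictures with
print's signs (−,+,−,−) of (3.26), the two decorated pictures (−,+), the ∿∗→∿ pieces = the two-vertex graphs read with the order-1
Taylor leg (−,+), the ∿∗∿ pieces = the four graphs with both wavy legs at x (−,+,−,−); `pic330_lhs`/`pic330_rhs`).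
§2 COUNT DATA.  `deg_dec330` (RHS₁,₂ have degree −d+3+α — p. 440's *"positive degree −d+3+α"*, `= α > 0` at d = 3; from p18's
`g325a_deg`/`g325b_deg` through `HolderPicture.deg`); `deg_tadpoles` ((3.25)₃,₄: D = 2 − d, p18); the p19 data DERIVED from the
drawings with p26's `countsOf`: **`countsOf_g325b = bubble δ325b`** (= `graph38`, p26 g28's `graph325b_eq_graph38`: p19's counts do not
see line types), **`countsOf_g325c = graph325c`**, **`countsOf_g325d = graph325d`** (p26 g28's tadpole data ARE the ones read off p18's
drawings: loop at the vertex, 0 ∕ 1 differentiation, η-power 0 ∕ 1); the vertex coefficients Π_{μμ′} = `Pi2`, Π_{μμ′ν} = `Pi3` enter §3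
by name (their printed sizes — *"bounded"*, *"proportional to (L^{j₀}η)^{−d+2}"* — are the analytic cells of the row: r15 §§4–6, p39's
F3 `B3Eq326ZeroLattice`, not restated).
§3 DICTIONARY.  `ampLeg` (p26/p37 amplitude of a localized picture whose second wavy leg is read by an arbitrary two-point leg function
F — F = g′A′ at x′: `ampV`; F = the order-1 Taylor term Σ_ν(x′−x)_ν(∂^η_νg′A′_{μ′})(x): `taylorLeg`; F = the remainder R: the decorated
pictures), `ampLeg_blob` (= r15's `pairSum` with the blob's kernel Π, by `VBlob.sum_pair`), `ampV_eq_ampLeg`; the one-vertex dictionary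
`ampV_natural_oneVertex` (vector version of p26's); `redKernel_blob325b`; **(2): `amp_g325b_T2`, `amp_g325c_T3`, `amp_g325d_T4`** (with
`amp_g325a_T1` of `B3Eq332Pictures`: ALL FOUR pictures of (3.25) ↦ T₁, T₂, T₃, T₄ of r15's `lhs326`, kernels `kerA`, `kerB`, tr q²G(x,x),
tr q²η(G∂^{η*}_μ)(x,x) read off the lines) ⇒ **`lhs326_eq_pics`** (r15's left side of (3.26) IS −A₁ + A₂ − A₃ − A₄ of the four drawn
pictures); **(1): `bracket326_eq_pics`** (∿∗∿: the square bracket IS the four pictures with both wavy legs localized at x, = the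
Π_{μμ′}-vertex form by r15's `bracket326_eq_Pi2`), **`curly1_eq_pics`** (∿∗→∿: the first curly bracket IS the two-vertex pictures read
with the order-1 Taylor leg, = the Π_{μμ′ν}-vertex form by `curly1_eq_Pi3`), **`curly2_eq_pics`** (the last curly bracket IS the two
decorated pictures read with the remainder leg R), `ampT`/`ampT_eq_ampLeg` (the drawn decoration performed: weight (η·supDist)^{1+α}
inserted and divided, for any leg function vanishing on the diagonal, η > 0), and **`eq330_pic`**: under Taylor's formula (3.10) for
the leg g′A′_{μ′} (hypothesis `hT`, as in r15's `eq326`), [−A₁ + A₂ − A₃ − A₄] = [∿∗∿ pieces] + [∿∗→∿ pieces] + [decorated pieces] —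
r15's PROVED `eq326` BY NAME; `eq330_pic_Pi` (the same with the two vertices in coefficient form `Pi2`/`Pi3` = p26 g28's
`eq330_termwise`).
HONEST SCOPE.  (i) As in `B3Eq37Pictures`/`B3Eq332Pictures`: localization/decoration data and amplitudes are this cell's READING of
pp. 417/440/442 on p18's model; kernels are supplied by the caller and are here r15's printed kernels of (3.26).  (ii) The two local
vertices of (3.30) are typed in the p. 417 way (the graphs with both wavy legs localized at x, resp. read with the order-1 Taylor
leg) together with their coefficient forms `Pi2`/`Pi3` by name; a dot-level drawn vertex (no internal line) is p26 g35's announced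
`DotPicture` (`B3Eq317Pictures`), to be instantiated for ∿∗∿/∿∗→∿ in an append-only v1.1 once it is in the tree (one dot vocabulary).
(iii) Signs: (3.30) prints "+" between pictures; the coefficients (−,+,−,−) are those of (3.26) in r15's reading T1 and are recorded
in `pic330`.  (iv) Nothing analytic is added: Taylor's formula (3.10) is the hypothesis `hT` exactly as in r15's `eq326`; the sizes
of the vertex coefficients, (3.27)–(3.29), the Ward–Takahashi step and the bounds on the last curly bracket are the row's other cells
(r15, p39 F3, p20, p32).  (v) d = 3, L = 2, δ₁ = 1 in the derived count data, as in `B3Eq330Members`.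
v1.1 (APPEND-ONLY, same seat and gen; TAKING line HOME/STATUS.md 2026-08-23T03:39Z; agreed with p26 g35 2026-08-23T03:06Z, *one dot
vocabulary*).  §Dots: the two local vertices of (3.30) and the vertex of (3.32) AS DOTS in p26 g35's `B3Eq317Pictures.DotPicture`
(p350659; a local generalized vertex with legs and arrowheads and NO internal line): **`dot330`** = ∿∗∿ (two wavy legs, no
arrowhead), **`dot330d`** = ∿∗→∿ (one arrowhead on the second wavy leg), `dot330_counts`, `degree_dot330` (D(v) = 2 ∕ 1 in r15's
count (2.1) — a count of the drawn dot, not the printed SIZE of its coefficient), the dot amplitudes **`amp330`** (coefficient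
c_{μμ′}(x), second leg F_{μ′}(x)) and **`amp330d`** (coefficient c_{μμ′ν}(x), arrowed leg ∂^η_ν(g′A′_{μ′})(x), ν summed), and the
identifications `bracket326_eq_amp330` (∿∗∿ with Π_{μμ′} = the square bracket, r15's `bracket326_eq_Pi2`), `curly1_eq_amp330d` (∿∗→∿
with Π_{μμ′ν} = the first curly bracket, `curly1_eq_Pi3`), `ampV_vertex_eq_amp330` (the vertex ∿×∿ of (3.32) for any blob = the dot
with coefficient Σ_{x′}η^dΠ_{μμ′}(x,x′), `B3Eq332Pictures.ampV_vertex_resummed`) and **`eq330_dot`** ((3.30) with both vertices as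
dots = r15's `eq326`).  Declarations of v1.0 unchanged.
Unit `lit-balaban-p37-g90` (literature-prover-lit-balaban-p37-g90-0), HOME `run/shared/lean/pub/lit-balaban/`, 2026-08-23.
-/

open Finset

namespace Literature.MathematicalPhysics.QuantumFieldTheory.Balaban1983to89.B3Eq330Pictures

/-! ## §1 The drawn objects: the four pictures (3.25) and the four right-hand pictures of (3.30) -/

section Pictures

open B3Prop1 B3Cor23Concrete B3Sect3LowestOrderGraphs B3Eq37Pictures B3Eq332Pictures

variable {nbar : ℕ}

/-! ### (3.25)₂ in closed form (p26's vertices `kind36`) -/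

/-- The lines of (3.25)₂ (p18's `g325b.other`, verbatim): the φ′-leg `j` of `i` is joined to the φ′-leg `j` of the other vertex —
the line through the two ARROWED legs `0` (doubly differentiated: the kernel (∂^η_{μ′}G∂^{η*}_μ)(x′,x)) and the plain line through the
legs `1`; the A′-legs are external. [cite: Balaban1983Higgs3, (3.25) p.439] -/
def other325b : Leg kind36 → Option (Leg kind36)
  | ⟨i, .inl j⟩ => some ⟨i.rev, .inl j⟩
  | ⟨_, .inr _⟩ => none

/-! ### (3.25)₃ in closed form: one vertex (1.10)_{2,0}, the plain straight loop -/

/-- The single vertex of (3.25)₃ is of the kind (1.10)_{n=2,n′=0} (p18's `g325c`). [cite: Balaban1983Higgs3, (3.25) p.439] -/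
def kind325c : Fin 1 → VertexKind := fun _ => .v110 2 0

/-- the φ′-leg `j` of the vertex of (3.25)₃ (no arrowhead: (1.10) carries no differentiation). [cite: Balaban1983Higgs3, (1.17) p.415] -/
def cLeg (j : Fin 2) : Leg kind325c := ⟨0, .inl j⟩

/-- the A′-leg `j` of the vertex of (3.25)₃ (both external: the two wavy legs). [cite: Balaban1983Higgs3, (1.17) p.415] -/
def cwLeg (j : Fin 2) : Leg kind325c := ⟨0, .inr j⟩

/-- The lines of (3.25)₃ (p18's `g325c.other`, verbatim): the two φ′-legs are joined (the loop), the A′-legs are external.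
[cite: Balaban1983Higgs3, (3.25) p.439] -/
def other325c : Leg kind325c → Option (Leg kind325c)
  | ⟨i, .inl j⟩ => some ⟨i, .inl j.rev⟩
  | ⟨_, .inr _⟩ => none

/-! ### (3.25)₄ in closed form: one vertex (1.8)_{2,0}, the straight loop through the arrowed leg -/

/-- The single vertex of (3.25)₄ is of the kind (1.8)_{n=2,n′=0} (p18's `g325d`). [cite: Balaban1983Higgs3, (3.25) p.439] -/
def kind325d : Fin 1 → VertexKind := fun _ => .v18 2 0

/-- the φ′-leg `j` of the vertex of (3.25)₄ (`j = 0`: the arrowed one). [cite: Balaban1983Higgs3, (1.17) p.415] -/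
def dLeg (j : Fin 2) : Leg kind325d := ⟨0, .inl j⟩

/-- the A′-leg `j` of the vertex of (3.25)₄ (both external). [cite: Balaban1983Higgs3, (1.17) p.415] -/
def dwLeg (j : Fin 2) : Leg kind325d := ⟨0, .inr j⟩

/-- The lines of (3.25)₄ (p18's `g325d.other`, verbatim): the two φ′-legs are joined (the loop, through the arrowed leg `0`), the
A′-legs are external. [cite: Balaban1983Higgs3, (3.25) p.439] -/
def other325d : Leg kind325d → Option (Leg kind325d)
  | ⟨i, .inl j⟩ => some ⟨i, .inl j.rev⟩
  | ⟨_, .inr _⟩ => none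

variable (hn : 1 ≤ nbar) (hn2 : 2 ≤ nbar)

/-- p18's `g325b`: vertices `kind36`, two of them, lines `other325b` (definitionally). [cite: Balaban1983Higgs3, (3.25) p.439] -/
theorem g325b_kind_nV : (g325b nbar hn).kind = kind36 ∧ (g325b nbar hn).nV = 2 := ⟨rfl, rfl⟩

/-- … the lines. [cite: Balaban1983Higgs3, (3.25) p.439] -/
theorem g325b_other (x : Leg kind36) : (g325b nbar hn).other x = other325b x := by
  obtain ⟨i, y⟩ := x
  rcases y with j | j <;> rfl

/-- p18's `g325c`: one vertex `kind325c`, lines `other325c` (definitionally). [cite: Balaban1983Higgs3, (3.25) p.439] -/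
theorem g325c_kind_nV : (g325c nbar hn2).kind = kind325c ∧ (g325c nbar hn2).nV = 1 := ⟨rfl, rfl⟩

/-- … the lines. [cite: Balaban1983Higgs3, (3.25) p.439] -/
theorem g325c_other (x : Leg kind325c) : (g325c nbar hn2).other x = other325c x := by
  obtain ⟨i, y⟩ := x
  rcases y with j | j <;> rfl

/-- p18's `g325d`: one vertex `kind325d`, lines `other325d` (definitionally). [cite: Balaban1983Higgs3, (3.25) p.439] -/
theorem g325d_kind_nV : (g325d nbar hn2).kind = kind325d ∧ (g325d nbar hn2).nV = 1 := ⟨rfl, rfl⟩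

/-- … the lines. [cite: Balaban1983Higgs3, (3.25) p.439] -/
theorem g325d_other (x : Leg kind325d) : (g325d nbar hn2).other x = other325d x := by
  obtain ⟨i, y⟩ := x
  rcases y with j | j <;> rfl

/-- **Line kinds of (3.25)₂**: the φ′-leg `j` of one vertex is joined to the φ′-leg `j` of the other — the line `0` runs through
BOTH arrowed legs, the line `1` through the two plain legs — and the wavy legs are external. DECIDED.
[cite: Balaban1983Higgs3, (3.25) p.439] -/
theorem g325b_lines :
    (∀ i j : Fin 2, other325b (sLeg i j) = some (sLeg i.rev j)) ∧ ∀ i : Fin 2, other325b (vLeg i) = none := by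
  refine ⟨by decide, by decide⟩

/-- **The external legs of (3.25)₂ are exactly its two A′-legs.** [cite: Balaban1983Higgs3, (3.25) p.439] -/
theorem other325b_eq_none_iff : ∀ x : Leg kind36, other325b x = none ↔ x = vLeg 0 ∨ x = vLeg 1 := by
  decide

/-- **Line kinds of (3.25)₃**: the straight loop joins the two φ′-legs of the vertex; the wavy legs are external. DECIDED.
[cite: Balaban1983Higgs3, (3.25) p.439] -/
theorem g325c_lines : (∀ j : Fin 2, other325c (cLeg j) = some (cLeg j.rev)) ∧ ∀ j : Fin 2, other325c (cwLeg j) = none := by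
  refine ⟨by decide, by decide⟩

/-- **Line kinds of (3.25)₄**: the straight loop joins the two φ′-legs (through the arrowed leg `0`); the wavy legs are external.
DECIDED. [cite: Balaban1983Higgs3, (3.25) p.439] -/
theorem g325d_lines : (∀ j : Fin 2, other325d (dLeg j) = some (dLeg j.rev)) ∧ ∀ j : Fin 2, other325d (dwLeg j) = none := by
  refine ⟨by decide, by decide⟩

/-- **The arrowheads**: the loop of (3.25)₄ passes through the differentiated leg of (1.8)_{2,0}, the loop of (3.25)₃ carries no
differentiation ((1.10) has none); in (3.25)₂ the leg `0` of each vertex is arrowed (p26's `legDiffs`).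
[cite: Balaban1983Higgs3, (3.25) p.439] -/
theorem legDiffs_325 :
    legDiffs (g325d nbar hn2) (dLeg 0) = 1 ∧ legDiffs (g325d nbar hn2) (dLeg 1) = 0 ∧
      (∀ j : Fin 2, legDiffs (g325c nbar hn2) (cLeg j) = 0) ∧
        ∀ i : Fin 2, legDiffs (g325b nbar hn) (sLeg i 0) = 1 ∧ legDiffs (g325b nbar hn) (sLeg i 1) = 0 := by
  refine ⟨rfl, rfl, fun j => ?_, fun i => ⟨rfl, rfl⟩⟩
  show (if j.val = 0 then (VertexKind.v110 2 0).diffCount else 0) = 0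
  simp [VertexKind.diffCount]

/-! ### The pictures -/

/-- **(3.25)₂ as a blob**: p18's `g325b`, the leg of A_μ = the A′-leg of `x = 0`, the leg of A′_{μ′} = the A′-leg of `x′ = 1`.
[cite: Balaban1983Higgs3, (3.25) p.439] -/
def blob325b (hn : 1 ≤ nbar) : VBlob nbar where
  G := g325b nbar hn
  e := vLeg 0
  e' := vLeg 1
  vec := rfl
  vec' := rfl
  ext := rfl
  ext' := rfl
  ne := by show (0 : Fin 2) ≠ 1; decide
  only x hx := (other325b_eq_none_iff x).1 (by rwa [g325b_other] at hx)

/-- **(3.25)₃** as a localized picture: p18's `g325c`, natural localization (ONE vertex: both wavy legs sit at it — the picture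
is local already, its p. 417-localization is itself, as for p26's tadpoles (3.7)₂,₃). [cite: Balaban1983Higgs3, (3.25) p.439] -/
def pic325c (hn2 : 2 ≤ nbar) : LocPicture nbar := LocPicture.natural (g325c nbar hn2)

/-- **(3.25)₄** as a localized picture: p18's `g325d`, natural localization (one vertex). [cite: Balaban1983Higgs3, (3.25) p.439] -/
def pic325d (hn2 : 2 ≤ nbar) : LocPicture nbar := LocPicture.natural (g325d nbar hn2)

/-- the data of the instances. [cite: Balaban1983Higgs3, (3.25) p.439] -/
theorem pics325_data :
    (blob325b hn).G = g325b nbar hn ∧ (blob325b hn).e = vLeg 0 ∧ (blob325b hn).e' = vLeg 1 ∧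
      (pic325c hn2).G = g325c nbar hn2 ∧ (pic325d hn2).G = g325d nbar hn2 :=
  ⟨rfl, rfl, rfl, rfl, rfl⟩

/-- The tadpoles are local: both wavy legs of (3.25)₃ and of (3.25)₄ sit at the single vertex. [cite: Balaban1983Higgs3, p.417] -/
theorem pic325cd_loc :
    (∀ j : Fin 2, (pic325c hn2).loc (cwLeg j) = (cwLeg 0).1) ∧ ∀ j : Fin 2, (pic325d hn2).loc (dwLeg j) = (dwLeg 0).1 :=
  ⟨fun _ => rfl, fun _ => rfl⟩

/-- **A Taylor-DECORATED picture**: a Hölder-decorated picture (`B3Eq332Pictures.HolderPicture`: blob exponent, decorated external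
leg, base vertex) together with the ORDER of the Taylor remainder its decorated leg carries — drawn as that many arrowheads on the
leg: order 1 in (3.12)/(3.22)/(3.30) (labels "+(1+α)" ∕ "−(1+α)"), order 0 in (3.20)/(3.32) ("+α" ∕ "−α").
[cite: Balaban1983Higgs3, (3.30) p.442] -/
structure TaylorPicture (nbar : ℕ) extends HolderPicture nbar where
  /-- the Taylor order carried by the decorated leg (its number of arrowheads) -/
  order : ℕ

/-- **RHS₁ of (3.30)**: (3.25)₁ inscribed "+(1+α)", its second wavy leg arrowed and labelled "−(1+α)" (the order-1 Taylor remainder of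
g′A′_{μ′} relative to x, divided by |x′−x|^{1+α}). [cite: Balaban1983Higgs3, (3.30) p.442] -/
noncomputable def dec330a (hn : 1 ≤ nbar) (α : ℝ) : TaylorPicture nbar where
  toHolderPicture := (blob325a hn).holder (1 + α)
  order := 1

/-- **RHS₂ of (3.30)**: (3.25)₂ decorated the same way. [cite: Balaban1983Higgs3, (3.30) p.442] -/
noncomputable def dec330b (hn : 1 ≤ nbar) (α : ℝ) : TaylorPicture nbar where
  toHolderPicture := (blob325b hn).holder (1 + α)
  order := 1

/-- The decorations: blob label 1 + α, ONE arrowhead on the decorated leg (= the second wavy leg `vLeg 1`, base x = `0`), same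
drawn graphs as (3.25)₁,₂. [cite: Balaban1983Higgs3, (3.30) p.442] -/
theorem dec330_data (α : ℝ) :
    ((dec330a hn α).α = 1 + α ∧ (dec330a hn α).order = 1 ∧ (dec330a hn α).wleg = vLeg 1 ∧ (dec330a hn α).G = g325a nbar hn) ∧
      ((dec330b hn α).α = 1 + α ∧ (dec330b hn α).order = 1 ∧ (dec330b hn α).wleg = vLeg 1 ∧ (dec330b hn α).G = g325b nbar hn) :=
  ⟨⟨rfl, rfl, rfl, rfl⟩, ⟨rfl, rfl, rfl, rfl⟩⟩

/-- **The picture equation (3.30) as a record of drawn objects** with the coefficients of (3.26) (print joins the pictures by "+";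
the signs −T₁ + T₂ − T₃ − T₄ of the left side of (3.26) and of its brackets, in r15's reading T1, are recorded with each piece):
`lhs` = the four pictures (3.25); `dec` = the two decorated pictures (the last curly bracket); `arrowVertex` = the pieces of the
vertex ∿∗→∿ (the two-vertex graphs read with the order-1 Taylor leg — the first curly bracket); `plainVertex` = the pieces of the
vertex ∿∗∿ (the four graphs with both wavy legs localized in x, p. 417 — the square bracket). [cite: Balaban1983Higgs3, (3.30) p.442] -/
structure PicEq330 (nbar : ℕ) where
  /-- the left side: signed pictures -/
  lhs : List (ℤ × LocPicture nbar)
  /-- the decorated pictures of the right side -/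
  dec : List (ℤ × TaylorPicture nbar)
  /-- the pieces of the vertex with the arrowed leg -/
  arrowVertex : List (ℤ × LocPicture nbar)
  /-- the pieces of the plain local vertex -/
  plainVertex : List (ℤ × LocPicture nbar)

/-- **(3.30)** p. 442 [PDF 32] for p18's four graphs (3.25) (n̄ ≥ 2 for the tadpole vertices). [cite: Balaban1983Higgs3, (3.30) p.442] -/
noncomputable def pic330 (hn2 : 2 ≤ nbar) (α : ℝ) : PicEq330 nbar :=
  let hn : 1 ≤ nbar := le_trans one_le_two hn2
  { lhs := [(-1, (blob325a hn).blob), (1, (blob325b hn).blob), (-1, pic325c hn2), (-1, pic325d hn2)]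
    dec := [(-1, dec330a hn α), (1, dec330b hn α)]
    arrowVertex := [(-1, (blob325a hn).blob), (1, (blob325b hn).blob)]
    plainVertex := [(-1, (blob325a hn).vertex), (1, (blob325b hn).vertex), (-1, pic325c hn2), (-1, pic325d hn2)] }

/-- The left side of (3.30) lists the four pictures of (3.25) with the signs of (3.26). [cite: Balaban1983Higgs3, (3.30) p.442] -/
theorem pic330_lhs (α : ℝ) :
    ((pic330 hn2 α).lhs.map Prod.fst = [-1, 1, -1, -1]) ∧
      (pic330 hn2 α).lhs.map (fun p => p.2.G) =
        [g325a nbar (le_trans one_le_two hn2), g325b nbar (le_trans one_le_two hn2), g325c nbar hn2, g325d nbar hn2] :=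
  ⟨rfl, rfl⟩

/-- The right side of (3.30): two decorated pictures, two pieces of ∿∗→∿, four pieces of ∿∗∿, with their signs.
[cite: Balaban1983Higgs3, (3.30) p.442] -/
theorem pic330_rhs (α : ℝ) :
    (pic330 hn2 α).dec.map Prod.fst = [-1, 1] ∧ (pic330 hn2 α).arrowVertex.map Prod.fst = [-1, 1] ∧
      (pic330 hn2 α).plainVertex.map Prod.fst = [-1, 1, -1, -1] :=
  ⟨rfl, rfl, rfl⟩

end Pictures

/-! ## §2 Count data: degrees of the decorated pictures, the data of (3.25)₂,₃,₄ derived from the drawings -/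

section Counting

open B3Prop1 B3Cor23Concrete B3Sect3LowestOrderGraphs B3Eq37Pictures B3Eq332Pictures
open B3Ineq215 B3Ineq213 B3TwoVertexBlocks B3Eq312Member B3Eq330Members

variable {nbar : ℕ}

noncomputable section

variable (hn : 1 ≤ nbar) (hn2 : 2 ≤ nbar)

/-- **p. 440: "they have positive degree −d+3+α"** — both decorated pictures of (3.30) have degree D + (1+α) = −d + 3 + α (p18's
`g325a_deg`/`g325b_deg` = 2 − d), i.e. α > 0 at d = 3. [cite: Balaban1983Higgs3, (3.26) p.440] -/
theorem deg_dec330 (α : ℝ) (d : ℕ) :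
    (dec330a hn α).deg d = -(d : ℝ) + 3 + α ∧ (dec330b hn α).deg d = -(d : ℝ) + 3 + α ∧ (dec330a hn α).deg 3 = α := by
  have ha : ∀ d : ℕ, (dec330a hn α).deg d = -(d : ℝ) + 3 + α := fun d => deg_holder_blob325a hn d α
  have hb : (dec330b hn α).deg d = -(d : ℝ) + 3 + α := by
    show ((g325b nbar hn).deg d : ℝ) + (1 + α) = _
    rw [g325b_deg]; push_cast; ring
  exact ⟨ha d, hb, by rw [ha 3]; push_cast; ring⟩

/-- **"(D = −d + 2)"** for the tadpoles (3.25)₃,₄ (p18's `g325c_deg`, `g325d_deg`): −1 at d = 3.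
[cite: Balaban1983Higgs3, (3.25) p.439] -/
theorem deg_tadpoles : (g325c nbar hn2).deg 3 = -1 ∧ (g325d nbar hn2).deg 3 = -1 := by
  rw [g325c_deg, g325d_deg]; norm_num

/-! ### The p19 count data DERIVED from the drawings (p26's `countsOf`) -/

/-- The two lines of (3.25)₂: line `l` from the φ′-leg `l` of x to the φ′-leg `l` of x′ (line `0` doubly arrowed).
[cite: Balaban1983Higgs3, (3.25) p.439] -/
def fst325b : Fin 2 → Leg kind36 := fun l => sLeg 0 l

/-- second endpoints of the two lines of (3.25)₂. [cite: Balaban1983Higgs3, (3.25) p.439] -/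
def snd325b : Fin 2 → Leg kind36 := fun l => sLeg 1 l

/-- The four properties of an enumeration for (3.25)₂, DECIDED. [cite: Balaban1983Higgs3, (2.16) p.428] -/
theorem enum325b_props :
    (∀ l : Fin 2, other325b (fst325b l) = some (snd325b l)) ∧
    (∀ x y : Leg kind36, other325b x = some y →
      ∃ l : Fin 2, (fst325b l = x ∧ snd325b l = y) ∨ (fst325b l = y ∧ snd325b l = x)) ∧
    (∀ l l' : Fin 2, (fst325b l = fst325b l' ∨ fst325b l = snd325b l') → l = l') ∧
    (∀ v : Fin 2, ∃ l : Fin 2, (fst325b l).1 = v ∨ (snd325b l).1 = v) := by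
  refine ⟨by decide, by decide, by decide, by decide⟩

/-- The lines of (3.25)₂ enumerated. [cite: Balaban1983Higgs3, (3.25) p.439] -/
def enum325b : LineEnum (g325b nbar hn) 2 where
  fst := fst325b
  snd := snd325b
  pair l := by rw [g325b_other]; exact enum325b_props.1 l
  cover x y h := enum325b_props.2.1 x y (by rwa [g325b_other] at h)
  nodup := enum325b_props.2.2.1
  touches := enum325b_props.2.2.2

/-- The loop of (3.25)₃ as the only line: its two legs are paired and every pairing is this one — DECIDED on the closed form.
[cite: Balaban1983Higgs3, (2.16) p.428] -/
theorem enum325c_props : other325c (cLeg 0) = some (cLeg 1) ∧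
    ∀ x y : Leg kind325c, other325c x = some y → (cLeg 0 = x ∧ cLeg 1 = y) ∨ (cLeg 0 = y ∧ cLeg 1 = x) :=
  ⟨by decide, by decide⟩

/-- The loop of (3.25)₄ as the only line — DECIDED on the closed form. [cite: Balaban1983Higgs3, (2.16) p.428] -/
theorem enum325d_props : other325d (dLeg 0) = some (dLeg 1) ∧
    ∀ x y : Leg kind325d, other325d x = some y → (dLeg 0 = x ∧ dLeg 1 = y) ∨ (dLeg 0 = y ∧ dLeg 1 = x) :=
  ⟨by decide, by decide⟩

/-- The loop of (3.25)₃ enumerated: from the φ′-leg `0` to the φ′-leg `1` of the vertex. [cite: Balaban1983Higgs3, (3.25) p.439] -/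
def enum325c : LineEnum (g325c nbar hn2) 1 where
  fst _ := cLeg 0
  snd _ := cLeg 1
  pair _ := by rw [g325c_other]; exact enum325c_props.1
  cover x y h := ⟨0, enum325c_props.2 x y (by rwa [g325c_other] at h)⟩
  nodup l l' _ := Subsingleton.elim _ _
  touches v := ⟨0, Or.inl (Subsingleton.elim (α := Fin 1) _ _)⟩

/-- The loop of (3.25)₄ enumerated: from the arrowed φ′-leg `0` to the φ′-leg `1`. [cite: Balaban1983Higgs3, (3.25) p.439] -/
def enum325d : LineEnum (g325d nbar hn2) 1 where
  fst _ := dLeg 0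
  snd _ := dLeg 1
  pair _ := by rw [g325d_other]; exact enum325d_props.1
  cover x y h := ⟨0, enum325d_props.2 x y (by rwa [g325d_other] at h)⟩
  nodup l l' _ := Subsingleton.elim _ _
  touches v := ⟨0, Or.inl (Subsingleton.elim (α := Fin 1) _ _)⟩

/-- kernel: equality of count data from equality of their data fields. [folklore] -/
private theorem counts_ext {V : Type} [Fintype V] [DecidableEq V] {m : ℕ} {C C' : Counts V m} (h1 : C.src = C'.src)
    (h2 : C.tgt = C'.tgt) (h3 : C.diffOn = C'.diffOn) (h4 : C.vecLegAvg = C'.vecLegAvg) (h5 : C.etaPow = C'.etaPow)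
    (h6 : C.d = C'.d) (h7 : C.L = C'.L) (h8 : C.δ₁ = C'.δ₁) : C = C' := by
  cases C; cases C'
  simp only at h1 h2 h3 h4 h5 h6 h7 h8
  subst h1 h2 h3 h4 h5 h6 h7 h8
  rfl

/-- p18's `g325b` carries p26's differentiations `legDiffs36` and no averaged legs. [cite: Balaban1983Higgs3, (2.1) p.422] -/
theorem legDiffs_g325b (x : Leg kind36) : legDiffs (g325b nbar hn) x = legDiffs36 x ∧ legAvg (g325b nbar hn) x = 0 := by
  obtain ⟨i, j | j⟩ := x <;> exact ⟨rfl, rfl⟩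

/-- The pattern read off (3.25)₂ IS p26 g28's `δ325b` (both vertices differentiate the line `0`) — DECIDED.
[cite: Balaban1983Higgs3, (2.14) p.427] -/
theorem pattern325b : ∀ v l : Fin 2,
    (if (fst325b l).1 = v then legDiffs36 (fst325b l) else 0) + (if (snd325b l).1 = v then legDiffs36 (snd325b l) else 0) =
      δ325b v l := by
  decide

/-- **The count datum of (3.25)₂ read off the drawing is `bubble δ325b`** (= `graph38`, p26 g28's `graph325b_eq_graph38`: p19's
counts see legs, differentiations and η-powers, not line types). [cite: Balaban1983Higgs3, (3.25) p.439, (2.14) p.427] -/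
theorem countsOf_g325b :
    countsOf (g325b nbar hn) (enum325b hn) 3 2 1 (by norm_num) le_rfl one_pos = bubble δ325b := by
  refine counts_ext ?_ ?_ ?_ ?_ ?_ rfl rfl rfl
  · funext l; rfl
  · funext l; rfl
  · funext v l
    show (if (fst325b l).1 = v then legDiffs (g325b nbar hn) (fst325b l) else 0) +
        (if (snd325b l).1 = v then legDiffs (g325b nbar hn) (snd325b l) else 0) = δ325b v l
    rw [(legDiffs_g325b hn _).1, (legDiffs_g325b hn _).1]
    exact pattern325b v l
  · funext v l
    show (if (fst325b l).1 = v then legAvg (g325b nbar hn) (fst325b l) else 0) +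
        (if (snd325b l).1 = v then legAvg (g325b nbar hn) (snd325b l) else 0) = 0
    rw [(legDiffs_g325b hn _).2, (legDiffs_g325b hn _).2]
    simp
  · funext v
    show ((VertexKind.v18 1 0).etaCount 3 - 3).toNat = 0
    decide

/-- hence the whole (3.25)₂ has the (3.8) count datum and degree −1 = p18's `g325b_deg 3` (p26 g28).
[cite: Balaban1983Higgs3, (3.25) p.439] -/
theorem countsOf_g325b_eq_graph38 :
    countsOf (g325b nbar hn) (enum325b hn) 3 2 1 (by norm_num) le_rfl one_pos = graph38 ∧ (g325b nbar hn).deg 3 = -1 := by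
  refine ⟨by rw [countsOf_g325b]; exact graph325b_eq_graph38, ?_⟩
  rw [g325b_deg]; norm_num

/-- **The count datum of (3.25)₃ read off the drawing is p26 g28's `graph325c`**: the loop at the vertex, no differentiation, proper
η-power `0` of (1.10)_{2,0}. [cite: Balaban1983Higgs3, (3.25) p.439, (2.14) p.427] -/
theorem countsOf_g325c :
    countsOf (g325c nbar hn2) (enum325c hn2) 3 2 1 (by norm_num) le_rfl one_pos = graph325c := by
  refine counts_ext ?_ ?_ ?_ ?_ ?_ rfl rfl rfl
  · funext l; exact Subsingleton.elim (α := Fin 1) _ _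
  · funext l; exact Subsingleton.elim (α := Fin 1) _ _
  · funext v l
    have hv : v = (cLeg 0).1 := Subsingleton.elim (α := Fin 1) _ _
    subst hv
    show (if (cLeg 0).1 = (cLeg 0).1 then legDiffs (g325c nbar hn2) (cLeg 0) else 0) +
        (if (cLeg 1).1 = (cLeg 0).1 then legDiffs (g325c nbar hn2) (cLeg 1) else 0) = 0
    rw [(legDiffs_325 (le_trans one_le_two hn2) hn2).2.2.1, (legDiffs_325 (le_trans one_le_two hn2) hn2).2.2.1]
    simp
  · funext v l
    show (if (cLeg 0).1 = v then legAvg (g325c nbar hn2) (cLeg 0) else 0) +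
        (if (cLeg 1).1 = v then legAvg (g325c nbar hn2) (cLeg 1) else 0) = 0
    have h0 : ∀ j : Fin 2, legAvg (g325c nbar hn2) (cLeg j) = 0 := fun _ => rfl
    rw [h0, h0]
    simp
  · funext v
    show ((VertexKind.v110 2 0).etaCount 3 - 3).toNat = 0
    decide

/-- **The count datum of (3.25)₄ read off the drawing is p26 g28's `graph325d`**: the loop at the vertex through the arrowed leg
(one differentiation), proper η-power `1` of (1.8)_{2,0}. [cite: Balaban1983Higgs3, (3.25) p.439, (2.14) p.427] -/
theorem countsOf_g325d :
    countsOf (g325d nbar hn2) (enum325d hn2) 3 2 1 (by norm_num) le_rfl one_pos = graph325d := by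
  refine counts_ext ?_ ?_ ?_ ?_ ?_ rfl rfl rfl
  · funext l; exact Subsingleton.elim (α := Fin 1) _ _
  · funext l; exact Subsingleton.elim (α := Fin 1) _ _
  · funext v l
    have hv : v = (dLeg 0).1 := Subsingleton.elim (α := Fin 1) _ _
    subst hv
    show (if (dLeg 0).1 = (dLeg 0).1 then legDiffs (g325d nbar hn2) (dLeg 0) else 0) +
        (if (dLeg 1).1 = (dLeg 0).1 then legDiffs (g325d nbar hn2) (dLeg 1) else 0) = 1
    rw [(legDiffs_325 (le_trans one_le_two hn2) hn2).1, (legDiffs_325 (le_trans one_le_two hn2) hn2).2.1]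
    simp
  · funext v l
    show (if (dLeg 0).1 = v then legAvg (g325d nbar hn2) (dLeg 0) else 0) +
        (if (dLeg 1).1 = v then legAvg (g325d nbar hn2) (dLeg 1) else 0) = 0
    have h0 : ∀ j : Fin 2, legAvg (g325d nbar hn2) (dLeg j) = 0 := fun _ => rfl
    rw [h0, h0]
    simp
  · funext v
    show ((VertexKind.v18 2 0).etaCount 3 - 3).toNat = 1
    decide

end

end Counting

/-! ## §3 The dictionary: (3.25) ↦ the left side of (3.26); (3.30) ↦ its three brackets -/

section Dictionary

open B3Prop1 B3Cor23Concrete B3Sect3LowestOrderGraphs B3Eq37Pictures B3Eq332Pictures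
open LatticeFieldCalculus B3Sect3ScalarSelfEnergy B3Sect3VectorSelfEnergy

noncomputable section

variable {nbar : ℕ} {P : Params} {j : ℕ}

/-- **The expression of a localized picture whose second wavy leg is read by an arbitrary two-point leg function** F_{μ′}(x,x′)
(evaluated at the localization vertices of the two external legs): Σ over all vertex positions of η^{(#vertices)d}Σ_{μμ′}
g(xs(loc e))A_μ(xs(loc e))·K(xs)_{μμ′}·F_{μ′}(xs(loc e), xs(loc e′)) — F = g′A′ at the far point gives `ampV`, F = the order-1 Taylor
term gives the pieces of ∿∗→∿, F = the remainder R the decorated pictures (r15's `pairSum` readings of (3.26)).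
[cite: Balaban1983Higgs3, (3.26) p.440] -/
def ampLeg (Pic : LocPicture nbar) (e e' : Leg Pic.G.kind) (η : ℝ) (K : (Fin Pic.G.nV → Site P j) → Fin P.d → Fin P.d → ℝ)
    (g : SiteField P j ℝ) (A : VecField P j ℝ) (F : Fin P.d → Site P j → Site P j → ℝ) : ℝ :=
  ∑ xs : Fin Pic.G.nV → Site P j, η ^ (Pic.G.nV * P.d) * ∑ μ : Fin P.d, ∑ μ' : Fin P.d,
    g (xs (Pic.loc e)) * A ⟨xs (Pic.loc e), μ⟩ * K xs μ μ' * F μ' (xs (Pic.loc e)) (xs (Pic.loc e'))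

/-- `ampV` is `ampLeg` with the leg g′(x′)A′_{μ′}(x′) (definitionally). [cite: Balaban1983Higgs3, (3.26) p.440] -/
theorem ampV_eq_ampLeg (Pic : LocPicture nbar) (e e' : Leg Pic.G.kind) (η : ℝ)
    (K : (Fin Pic.G.nV → Site P j) → Fin P.d → Fin P.d → ℝ) (g g' : SiteField P j ℝ) (A A' : VecField P j ℝ) :
    ampV Pic e e' η K g g' A A' = ampLeg Pic e e' η K g A (fun μ' _ x' => g' x' * A' ⟨x', μ'⟩) := rfl

/-- For a blob with its natural localization, `ampLeg` IS r15's `pairSum` with the blob's kernel Π (`VBlob.sum_pair`).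
[cite: Balaban1983Higgs3, (3.26) p.440] -/
theorem ampLeg_blob (B : VBlob nbar) (η : ℝ) (K : (Fin B.G.nV → Site P j) → Fin P.d → Fin P.d → ℝ) (g : SiteField P j ℝ)
    (A : VecField P j ℝ) (F : Fin P.d → Site P j → Site P j → ℝ) :
    ampLeg B.blob B.e B.e' η K g A F = pairSum η (B.redKernel η K) g A F := by
  unfold ampLeg
  exact B.sum_pair η K g A F

/-- **The order-1 Taylor leg** Σ_ν (x′_ν − x_ν)(∂^η_νg′A′_{μ′})(x) of (3.10)/(3.26) (`dx ν x x′` = x′_ν − x_ν along Γ_{x,x′}, `D ν μ′`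
= ∂^η_ν(g′A′_{μ′}), as in r15's `eq326`): the reading of the arrowed wavy leg of ∿∗→∿ — the field at x, the displacement joining
the kernel. [cite: Balaban1983Higgs3, (3.26) p.440] -/
def taylorLeg (dx : Fin P.d → Site P j → Site P j → ℝ) (D : Fin P.d → Fin P.d → SiteField P j ℝ) :
    Fin P.d → Site P j → Site P j → ℝ :=
  fun μ' x x' => ∑ ν : Fin P.d, dx ν x x' * D ν μ' x

/-- kernel: a sum over all positions of ONE vertex is a sum over the torus. [folklore] -/
private def arrowOneEquiv {n : ℕ} (i : Fin n) (hn1 : n = 1) (S : Type*) : (Fin n → S) ≃ S where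
  toFun xs := xs i
  invFun x := fun _ => x
  left_inv xs := by
    have : Subsingleton (Fin n) := by rw [hn1]; infer_instance
    funext k
    rw [Subsingleton.elim k i]
  right_inv _ := rfl

/-- **The one-vertex dictionary** (vector version of p26's `amp_natural_oneVertex`): for a ONE-vertex picture with its natural
localization both wavy legs sit at the vertex, and with a kernel depending on its position,
amp = Σ_x η^d Σ_{μμ′} g(x)A_μ(x)·c_{μμ′}(x)·g′(x)A′_{μ′}(x). [cite: Balaban1983Higgs3, (3.26) p.440] -/
theorem ampV_natural_oneVertex (G : Graph nbar) (hG : G.nV = 1) (e e' : Leg G.kind) (η : ℝ)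
    (c : Site P j → Fin P.d → Fin P.d → ℝ) (g g' : SiteField P j ℝ) (A A' : VecField P j ℝ) :
    ampV (LocPicture.natural G) e e' η (fun xs μ μ' => c (xs e.1) μ μ') g g' A A' =
      ∑ x : Site P j, η ^ P.d * ∑ μ : Fin P.d, ∑ μ' : Fin P.d, g x * A ⟨x, μ⟩ * c x μ μ' * (g' x * A' ⟨x, μ'⟩) := by
  have he : e'.1 = e.1 := by
    have : Subsingleton (Fin G.nV) := by rw [hG]; infer_instance
    exact Subsingleton.elim _ _
  unfold ampV LocPicture.natural
  simp only [hG, one_mul, he]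
  exact Fintype.sum_equiv (arrowOneEquiv e.1 hG (Site P j)) _ _ fun _ => rfl

variable (hn : 1 ≤ nbar) (hn2 : 2 ≤ nbar)

/-- For the two-vertex blob (3.25)₂ there is no internal vertex to sum: Π = the supplied two-point kernel.
[cite: Balaban1983Higgs3, (3.26) p.440] -/
theorem redKernel_blob325b (η : ℝ) (Kr : Fin P.d → Fin P.d → Kernel P j) :
    (blob325b hn).redKernel η (kernelV2 Kr) = Kr := by
  have h : (blob325b hn).redKernel η (kernelV2 Kr) = (blob325a hn).redKernel η (kernelV2 Kr) := by
    unfold VBlob.redKernel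
    rfl
  rw [h, redKernel_blob325a]

/-! ### (2): ALL FOUR pictures of (3.25) ↦ the four terms of the left side of (3.26) -/

/-- **(3.25)₂ ↦ T₂**: with r15's kernel `kerB` of its lines (tr q² G^η_{(j)}(0;x,x′)(∂^η_{μ′}G^η_{(j′)}(0)∂^{η*}_μ)(x′,x): the plain
line and the doubly arrowed line) the natural picture of (3.25)₂ reads as T₂ of the left side of (3.26) (`pairSum η kerB g A
(legFar g′ A′)`), and its p. 417-localization as the T₂′ piece of the square bracket (`legNear`). [cite: Balaban1983Higgs3, (3.26) p.440] -/
theorem amp_g325b_T2 (η τ : ℝ) (Gj Gj' : Kernel P j) (g g' : SiteField P j ℝ) (A A' : VecField P j ℝ) :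
    ampV (blob325b hn).blob (vLeg 0) (vLeg 1) η (kernelV2 (kerB η τ Gj Gj')) g g' A A' =
        pairSum η (kerB η τ Gj Gj') g A (legFar g' A') ∧
      ampV (blob325b hn).vertex (vLeg 0) (vLeg 1) η (kernelV2 (kerB η τ Gj Gj')) g g' A A' =
        pairSum η (kerB η τ Gj Gj') g A (legNear g' A') := by
  have h1 := ampV_blob (blob325b hn) η (kernelV2 (kerB η τ Gj Gj')) g g' A A'
  have h2 := ampV_vertex (blob325b hn) η (kernelV2 (kerB η τ Gj Gj')) g g' A A'
  rw [redKernel_blob325b] at h1 h2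
  exact ⟨h1, h2⟩

/-- The local kernel of (3.25)₃ READ OFF THE DRAWING: the plain straight loop ↦ the diagonal tr q² G^η_{(j″)}(0;x,x) of the scalar
propagator, the two wavy legs of the single vertex in the same direction (δ_{μμ′}). [cite: Balaban1983Higgs3, (3.26) p.440] -/
def c325c (τ : ℝ) (Gj'' : Kernel P j) (x : Site P j) (μ μ' : Fin P.d) : ℝ := if μ = μ' then τ * Gj'' x x else 0

/-- The local kernel of (3.25)₄ READ OFF THE DRAWING: the straight loop through the arrowed leg ↦ tr q² η(G^η_{(j″)}(0)∂^{η*}_μ)(x,x)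
(r15's `dAdjKernel`), δ_{μμ′}. [cite: Balaban1983Higgs3, (3.26) p.440] -/
def c325d (η τ : ℝ) (Gj'' : Kernel P j) (x : Site P j) (μ μ' : Fin P.d) : ℝ :=
  if μ = μ' then τ * (η * dAdjKernel η⁻¹ μ Gj'' x x) else 0

/-- **(3.25)₃ ↦ T₃**: the tadpole picture with its loop kernel reads as the local term T₃ of (3.26) (r15's `term3` =
Σ_xη^dΣ_μ g(x)A_μ(x)g′(x)A′_μ(x) tr q² G^η_{(j″)}(0;x,x)). [cite: Balaban1983Higgs3, (3.26) p.440] -/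
theorem amp_g325c_T3 (η τ : ℝ) (Gj'' : Kernel P j) (g g' : SiteField P j ℝ) (A A' : VecField P j ℝ) :
    ampV (pic325c hn2) (cwLeg 0) (cwLeg 1) η (fun xs μ μ' => c325c τ Gj'' (xs (cwLeg 0).1) μ μ') g g' A A' =
      term3 η τ Gj'' g g' A A' := by
  unfold pic325c
  rw [ampV_natural_oneVertex (g325c nbar hn2) rfl]
  unfold term3 c325c
  refine Finset.sum_congr rfl fun x _ => ?_
  congr 1
  simp only [mul_ite, ite_mul, mul_zero, zero_mul, Finset.sum_ite_eq, Finset.mem_univ, if_true]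
  exact Finset.sum_congr rfl fun μ _ => by ring

/-- **(3.25)₄ ↦ T₄**: the tadpole picture with its arrowed-loop kernel reads as the local term T₄ of (3.26) (r15's `term4` =
Σ_xη^dΣ_μ g(x)A_μ(x)g′(x)A′_μ(x) tr q² η(G^η_{(j″)}(0)∂^{η*}_μ)(x,x)). [cite: Balaban1983Higgs3, (3.26) p.440] -/
theorem amp_g325d_T4 (η τ : ℝ) (Gj'' : Kernel P j) (g g' : SiteField P j ℝ) (A A' : VecField P j ℝ) :
    ampV (pic325d hn2) (dwLeg 0) (dwLeg 1) η (fun xs μ μ' => c325d η τ Gj'' (xs (dwLeg 0).1) μ μ') g g' A A' =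
      term4 η τ Gj'' g g' A A' := by
  unfold pic325d
  rw [ampV_natural_oneVertex (g325d nbar hn2) rfl]
  unfold term4 c325d
  refine Finset.sum_congr rfl fun x _ => ?_
  congr 1
  simp only [mul_ite, ite_mul, mul_zero, zero_mul, Finset.sum_ite_eq, Finset.mem_univ, if_true]
  exact Finset.sum_congr rfl fun μ _ => by ring

/-- **THE LEFT SIDE OF (3.26) IS −A₁ + A₂ − A₃ − A₄ OF THE FOUR DRAWN PICTURES (3.25)** (r15's `lhs326 = −T₁ + T₂ − T₃ − T₄`;
A₁ = `amp_g325a_T1` of `B3Eq332Pictures`, A₂, A₃, A₄ above). [cite: Balaban1983Higgs3, (3.26) p.440] -/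
theorem lhs326_eq_pics (η τ : ℝ) (Gj Gj' Gj'' : Kernel P j) (g g' : SiteField P j ℝ) (A A' : VecField P j ℝ) :
    lhs326 η τ Gj Gj' Gj'' g g' A A' =
      -ampV (blob325a hn).blob (vLeg 0) (vLeg 1) η (kernelV2 (kerA η τ Gj Gj')) g g' A A' +
          ampV (blob325b hn).blob (vLeg 0) (vLeg 1) η (kernelV2 (kerB η τ Gj Gj')) g g' A A' -
        ampV (pic325c hn2) (cwLeg 0) (cwLeg 1) η (fun xs μ μ' => c325c τ Gj'' (xs (cwLeg 0).1) μ μ') g g' A A' -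
      ampV (pic325d hn2) (dwLeg 0) (dwLeg 1) η (fun xs μ μ' => c325d η τ Gj'' (xs (dwLeg 0).1) μ μ') g g' A A' := by
  rw [(amp_g325a_T1 hn η τ Gj Gj' g g' A A').1, (amp_g325b_T2 hn η τ Gj Gj' g g' A A').1, amp_g325c_T3, amp_g325d_T4]
  rfl

/-! ### (1): the four right-hand pictures of (3.30) ↦ the three brackets of (3.26) -/

/-- **∿∗∿, the square bracket of (3.26)**: r15's `bracket326` IS −V₁ + V₂ − A₃ − A₄, the two-vertex pictures with BOTH wavy legs
localized at x (p. 417) and the (already local) tadpoles — the pieces of the vertex ∿∗∿ of (3.30); its coefficient form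
Σ_xη^dΣ_{μμ′} g(x)A_μ(x)Π_{μμ′}(x)g′(x)A′_{μ′}(x) is r15's `bracket326_eq_Pi2`. [cite: Balaban1983Higgs3, (3.30) p.442] -/
theorem bracket326_eq_pics (η τ : ℝ) (Gj Gj' Gj'' : Kernel P j) (g g' : SiteField P j ℝ) (A A' : VecField P j ℝ) :
    bracket326 η τ Gj Gj' Gj'' g g' A A' =
      -ampV (blob325a hn).vertex (vLeg 0) (vLeg 1) η (kernelV2 (kerA η τ Gj Gj')) g g' A A' +
          ampV (blob325b hn).vertex (vLeg 0) (vLeg 1) η (kernelV2 (kerB η τ Gj Gj')) g g' A A' -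
        ampV (pic325c hn2) (cwLeg 0) (cwLeg 1) η (fun xs μ μ' => c325c τ Gj'' (xs (cwLeg 0).1) μ μ') g g' A A' -
      ampV (pic325d hn2) (dwLeg 0) (dwLeg 1) η (fun xs μ μ' => c325d η τ Gj'' (xs (dwLeg 0).1) μ μ') g g' A A' := by
  rw [(amp_g325a_T1 hn η τ Gj Gj' g g' A A').2, (amp_g325b_T2 hn η τ Gj Gj' g g' A A').2, amp_g325c_T3, amp_g325d_T4]
  rfl

/-- kernel: a pairing whose leg carries a factor dx(x,x′) is the pairing with dx moved into the kernel.
[cite: Balaban1983Higgs3, (3.26) p.440] -/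
private theorem pairSum_mul_leg (η : ℝ) (K : Fin P.d → Fin P.d → Kernel P j) (g : SiteField P j ℝ) (A : VecField P j ℝ)
    (w : Site P j → Site P j → ℝ) (Fl : Fin P.d → SiteField P j ℝ) :
    pairSum η K g A (fun μ' x x' => w x x' * Fl μ' x) =
      pairSum η (fun μ μ' x x' => K μ μ' x x' * w x x') g A (fun μ' x _ => Fl μ' x) := by
  unfold pairSum
  refine Finset.sum_congr rfl fun x _ => Finset.sum_congr rfl fun x' _ => ?_
  congr 1
  exact Finset.sum_congr rfl fun μ _ => Finset.sum_congr rfl fun μ' _ => by ring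

/-- **∿∗→∿, the first curly bracket of (3.26)**: r15's `curly1` IS −W₁ + W₂, the two-vertex pictures (3.25)₁,₂ read with the
order-1 Taylor leg Σ_ν(x′_ν − x_ν)(∂^η_νg′A′_{μ′})(x) — the pieces of the vertex ∿∗→∿ of (3.30), whose arrowed leg is
(∂^η_νg′A′_{μ′})(x); its coefficient form with Π_{μμ′ν}(x) is r15's `curly1_eq_Pi3`. [cite: Balaban1983Higgs3, (3.30) p.442] -/
theorem curly1_eq_pics (η τ : ℝ) (Gj Gj' : Kernel P j) (g : SiteField P j ℝ) (A : VecField P j ℝ)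
    (dx : Fin P.d → Site P j → Site P j → ℝ) (D : Fin P.d → Fin P.d → SiteField P j ℝ) :
    curly1 η τ Gj Gj' g A dx D =
      -ampLeg (blob325a hn).blob (vLeg 0) (vLeg 1) η (kernelV2 (kerA η τ Gj Gj')) g A (taylorLeg dx D) +
        ampLeg (blob325b hn).blob (vLeg 0) (vLeg 1) η (kernelV2 (kerB η τ Gj Gj')) g A (taylorLeg dx D) := by
  have h1 := ampLeg_blob (blob325a hn) η (kernelV2 (kerA η τ Gj Gj')) g A (taylorLeg dx D)
  have h2 := ampLeg_blob (blob325b hn) η (kernelV2 (kerB η τ Gj Gj')) g A (taylorLeg dx D)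
  rw [redKernel_blob325a] at h1
  rw [redKernel_blob325b] at h2
  have e1 : ampLeg (blob325a hn).blob (vLeg 0) (vLeg 1) η (kernelV2 (kerA η τ Gj Gj')) g A (taylorLeg dx D) =
      pairSum η (kerA η τ Gj Gj') g A (taylorLeg dx D) := h1
  have e2 : ampLeg (blob325b hn).blob (vLeg 0) (vLeg 1) η (kernelV2 (kerB η τ Gj Gj')) g A (taylorLeg dx D) =
      pairSum η (kerB η τ Gj Gj') g A (taylorLeg dx D) := h2
  rw [e1, e2, ← pairSum_kerC]
  unfold curly1 taylorLeg
  rw [pairSum_sum_leg η (kerC η τ Gj Gj') g A (fun ν μ' x x' => dx ν x x' * D ν μ' x)]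
  exact Finset.sum_congr rfl fun ν _ => (pairSum_mul_leg η (kerC η τ Gj Gj') g A (dx ν) (D ν)).symm

/-- **The two decorated pictures, the last curly bracket of (3.26)**: r15's `curly2` (kernel tr q²[−(…)(…) + (…)(…)] = `kerC`
paired with the Taylor remainder leg R_{μ′}(x,x′)) IS −H₁ + H₂, the pictures (3.25)₁,₂ read with the remainder leg R (the printed
weight |x′−x|^{1+α} inserted and divided changes nothing: `ampT_eq_ampLeg`). [cite: Balaban1983Higgs3, (3.30) p.442] -/
theorem curly2_eq_pics (η τ : ℝ) (Gj Gj' : Kernel P j) (g : SiteField P j ℝ) (A : VecField P j ℝ)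
    (R : Fin P.d → Site P j → Site P j → ℝ) :
    curly2 η τ Gj Gj' g A R =
      -ampLeg (blob325a hn).blob (vLeg 0) (vLeg 1) η (kernelV2 (kerA η τ Gj Gj')) g A R +
        ampLeg (blob325b hn).blob (vLeg 0) (vLeg 1) η (kernelV2 (kerB η τ Gj Gj')) g A R := by
  have h1 := ampLeg_blob (blob325a hn) η (kernelV2 (kerA η τ Gj Gj')) g A R
  have h2 := ampLeg_blob (blob325b hn) η (kernelV2 (kerB η τ Gj Gj')) g A R
  rw [redKernel_blob325a] at h1
  rw [redKernel_blob325b] at h2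
  have e1 : ampLeg (blob325a hn).blob (vLeg 0) (vLeg 1) η (kernelV2 (kerA η τ Gj Gj')) g A R =
      pairSum η (kerA η τ Gj Gj') g A R := h1
  have e2 : ampLeg (blob325b hn).blob (vLeg 0) (vLeg 1) η (kernelV2 (kerB η τ Gj Gj')) g A R =
      pairSum η (kerB η τ Gj Gj') g A R := h2
  rw [e1, e2, ← pairSum_kerC]
  rfl

/-- **The expression of a Taylor-decorated picture with wavy legs, decoration performed**: as `ampLeg`, the decorated leg reading
|x_b − x_w|^{α_H}·(R_{μ′}(x_b, x_w)/|x_b − x_w|^{α_H}) with α_H the blob exponent (here 1+α), |·| = η·`supDist` (r15's convention in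
`eq331`), x_b = xs(base), x_w = xs(loc wleg). [cite: Balaban1983Higgs3, (3.30) p.442] -/
def ampT (T : TaylorPicture nbar) (e : Leg T.G.kind) (η : ℝ) (K : (Fin T.G.nV → Site P j) → Fin P.d → Fin P.d → ℝ)
    (g : SiteField P j ℝ) (A : VecField P j ℝ) (R : Fin P.d → Site P j → Site P j → ℝ) : ℝ :=
  ∑ xs : Fin T.G.nV → Site P j, η ^ (T.G.nV * P.d) * ∑ μ : Fin P.d, ∑ μ' : Fin P.d,
    g (xs (T.loc e)) * A ⟨xs (T.loc e), μ⟩ * K xs μ μ' *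
      ((η * supDist (xs T.base) (xs (T.loc T.wleg))) ^ T.α *
        (R μ' (xs T.base) (xs (T.loc T.wleg)) / (η * supDist (xs T.base) (xs (T.loc T.wleg))) ^ T.α))

/-- kernel: on the torus, sup-distance 0 means equality (as in r15's `eq331`). [folklore] -/
private theorem eq_of_supDist_eq_zero (x x' : Site P j) (h : supDist x x' = 0) : x = x' := by
  funext μ
  have hle : min (x μ - x' μ).val (x' μ - x μ).val ≤ supDist x x' :=
    Finset.le_sup (f := fun μ : Fin P.d => min (x μ - x' μ).val (x' μ - x μ).val) (Finset.mem_univ μ)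
  rw [h, Nat.le_zero, Nat.min_eq_zero_iff, ZMod.val_eq_zero, ZMod.val_eq_zero, sub_eq_zero, sub_eq_zero] at hle
  rcases hle with h1 | h1
  · exact h1
  · exact h1.symm

/-- kernel: inserting and dividing the weight changes nothing for a leg function vanishing on the diagonal (η > 0).
[cite: Balaban1983Higgs3, (3.30) p.442] -/
private theorem weight_mul_div (η β : ℝ) (hη : 0 < η) (x x' : Site P j) (r : ℝ) (hr : x = x' → r = 0) :
    (η * supDist x x') ^ β * (r / (η * supDist x x') ^ β) = r := by
  by_cases hw : (η * (supDist x x' : ℝ)) ^ β = 0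
  · have hnn : 0 ≤ η * (supDist x x' : ℝ) := by positivity
    rw [Real.rpow_eq_zero_iff_of_nonneg hnn] at hw
    have h1 : (supDist x x' : ℝ) = 0 := by
      rcases mul_eq_zero.1 hw.1 with h2 | h2
      · exact absurd h2 hη.ne'
      · exact h2
    have hx : x = x' := eq_of_supDist_eq_zero x x' (by exact_mod_cast h1)
    rw [hr hx, zero_div, mul_zero]
  · exact mul_div_cancel₀ r hw

/-- **The drawn decoration performed**: for η > 0 and a leg function R vanishing on the diagonal (the Taylor remainder does:
R_{μ′}(x,x) = 0), the decorated amplitude of `dec330a`/`dec330b` (weight (η·supDist)^{1+α} inserted and divided) equals the plain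
reading with the leg R. [cite: Balaban1983Higgs3, (3.30) p.442] -/
theorem ampT_eq_ampLeg (η α : ℝ) (hη : 0 < η) (Kr Kr' : Fin P.d → Fin P.d → Kernel P j) (g : SiteField P j ℝ)
    (A : VecField P j ℝ) (R : Fin P.d → Site P j → Site P j → ℝ) (hR : ∀ (μ' : Fin P.d) (x : Site P j), R μ' x x = 0) :
    ampT (dec330a hn α) (vLeg 0) η (kernelV2 Kr) g A R =
        ampLeg (blob325a hn).blob (vLeg 0) (vLeg 1) η (kernelV2 Kr) g A R ∧
      ampT (dec330b hn α) (vLeg 0) η (kernelV2 Kr') g A R =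
        ampLeg (blob325b hn).blob (vLeg 0) (vLeg 1) η (kernelV2 Kr') g A R := by
  constructor
  · unfold ampT ampLeg
    refine Finset.sum_congr rfl fun xs _ => ?_
    have hw : ∀ μ' : Fin P.d,
        (η * supDist (xs (dec330a hn α).base) (xs ((dec330a hn α).loc (dec330a hn α).wleg))) ^ (dec330a hn α).α *
            (R μ' (xs (dec330a hn α).base) (xs ((dec330a hn α).loc (dec330a hn α).wleg)) /
              (η * supDist (xs (dec330a hn α).base) (xs ((dec330a hn α).loc (dec330a hn α).wleg))) ^ (dec330a hn α).α) =
          R μ' (xs (dec330a hn α).base) (xs ((dec330a hn α).loc (dec330a hn α).wleg)) :=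
      fun μ' => weight_mul_div η _ hη _ _ _ fun h => by rw [h]; exact hR μ' _
    simp only [hw]
    rfl
  · unfold ampT ampLeg
    refine Finset.sum_congr rfl fun xs _ => ?_
    have hw : ∀ μ' : Fin P.d,
        (η * supDist (xs (dec330b hn α).base) (xs ((dec330b hn α).loc (dec330b hn α).wleg))) ^ (dec330b hn α).α *
            (R μ' (xs (dec330b hn α).base) (xs ((dec330b hn α).loc (dec330b hn α).wleg)) /
              (η * supDist (xs (dec330b hn α).base) (xs ((dec330b hn α).loc (dec330b hn α).wleg))) ^ (dec330b hn α).α) =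
          R μ' (xs (dec330b hn α).base) (xs ((dec330b hn α).loc (dec330b hn α).wleg)) :=
      fun μ' => weight_mul_div η _ hη _ _ _ fun h => by rw [h]; exact hR μ' _
    simp only [hw]
    rfl

/-- **(3.30) IS (3.26) through the dictionary** — *"Let us write the effect of the above transformations in the following graphical
form (3.30)"*: under Taylor's formula (3.10) for the leg g′A′_{μ′} (hypothesis `hT`, verbatim as in r15's `eq326`: g′(x′)A′_{μ′}(x′) =
g′(x)A′_{μ′}(x) + Σ_ν(x′_ν − x_ν)(∂^η_νg′A′_{μ′})(x) + R_{μ′}(x,x′)), for all kernels and fields: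
[−A₁ + A₂ − A₃ − A₄] (the four drawn pictures (3.25)) = [−V₁ + V₂ − A₃ − A₄] (the vertex ∿∗∿) + [−W₁ + W₂] (the vertex ∿∗→∿) +
[−H₁ + H₂] (the two decorated pictures) — r15's PROVED `eq326` BY NAME. [cite: Balaban1983Higgs3, (3.30) p.442] -/
theorem eq330_pic (η τ : ℝ) (Gj Gj' Gj'' : Kernel P j) (g g' : SiteField P j ℝ) (A A' : VecField P j ℝ)
    (dx : Fin P.d → Site P j → Site P j → ℝ) (D : Fin P.d → Fin P.d → SiteField P j ℝ)
    (R : Fin P.d → Site P j → Site P j → ℝ)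
    (hT : ∀ (μ' : Fin P.d) (x x' : Site P j),
      g' x' * A' ⟨x', μ'⟩ = g' x * A' ⟨x, μ'⟩ + (∑ ν : Fin P.d, dx ν x x' * D ν μ' x) + R μ' x x') :
    -ampV (blob325a hn).blob (vLeg 0) (vLeg 1) η (kernelV2 (kerA η τ Gj Gj')) g g' A A' +
          ampV (blob325b hn).blob (vLeg 0) (vLeg 1) η (kernelV2 (kerB η τ Gj Gj')) g g' A A' -
        ampV (pic325c hn2) (cwLeg 0) (cwLeg 1) η (fun xs μ μ' => c325c τ Gj'' (xs (cwLeg 0).1) μ μ') g g' A A' -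
      ampV (pic325d hn2) (dwLeg 0) (dwLeg 1) η (fun xs μ μ' => c325d η τ Gj'' (xs (dwLeg 0).1) μ μ') g g' A A' =
    (-ampV (blob325a hn).vertex (vLeg 0) (vLeg 1) η (kernelV2 (kerA η τ Gj Gj')) g g' A A' +
          ampV (blob325b hn).vertex (vLeg 0) (vLeg 1) η (kernelV2 (kerB η τ Gj Gj')) g g' A A' -
        ampV (pic325c hn2) (cwLeg 0) (cwLeg 1) η (fun xs μ μ' => c325c τ Gj'' (xs (cwLeg 0).1) μ μ') g g' A A' -
      ampV (pic325d hn2) (dwLeg 0) (dwLeg 1) η (fun xs μ μ' => c325d η τ Gj'' (xs (dwLeg 0).1) μ μ') g g' A A') +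
    (-ampLeg (blob325a hn).blob (vLeg 0) (vLeg 1) η (kernelV2 (kerA η τ Gj Gj')) g A (taylorLeg dx D) +
      ampLeg (blob325b hn).blob (vLeg 0) (vLeg 1) η (kernelV2 (kerB η τ Gj Gj')) g A (taylorLeg dx D)) +
    (-ampLeg (blob325a hn).blob (vLeg 0) (vLeg 1) η (kernelV2 (kerA η τ Gj Gj')) g A R +
      ampLeg (blob325b hn).blob (vLeg 0) (vLeg 1) η (kernelV2 (kerB η τ Gj Gj')) g A R) := by
  rw [← lhs326_eq_pics, ← bracket326_eq_pics, ← curly1_eq_pics, ← curly2_eq_pics]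
  exact eq326 η τ Gj Gj' Gj'' g g' A A' dx D R hT

/-- **(3.30) with the two vertices in coefficient form** (p. 440/441: the square bracket *"has the form Σ_xη^dΣ gA_μΠ_{μμ′}(x)g′A′_{μ′}"*,
the first curly bracket *"has the form Σ_νΣ_xη^dΣ gA_μΠ_{μμ′ν}(x)(∂^η_νg′A′_{μ′})(x)"*; r15's `Pi2`/`Pi3`, p26 g28's `eq330_termwise`):
[−A₁ + A₂ − A₃ − A₄] = [∿∗∿ with coefficient Π_{μμ′}] + [∿∗→∿ with coefficient Π_{μμ′ν}] + [−H₁ + H₂].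
[cite: Balaban1983Higgs3, (3.30) p.442] -/
theorem eq330_pic_Pi (η τ : ℝ) (Gj Gj' Gj'' : Kernel P j) (g g' : SiteField P j ℝ) (A A' : VecField P j ℝ)
    (dx : Fin P.d → Site P j → Site P j → ℝ) (D : Fin P.d → Fin P.d → SiteField P j ℝ)
    (R : Fin P.d → Site P j → Site P j → ℝ)
    (hT : ∀ (μ' : Fin P.d) (x x' : Site P j),
      g' x' * A' ⟨x', μ'⟩ = g' x * A' ⟨x, μ'⟩ + (∑ ν : Fin P.d, dx ν x x' * D ν μ' x) + R μ' x x') :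
    -ampV (blob325a hn).blob (vLeg 0) (vLeg 1) η (kernelV2 (kerA η τ Gj Gj')) g g' A A' +
          ampV (blob325b hn).blob (vLeg 0) (vLeg 1) η (kernelV2 (kerB η τ Gj Gj')) g g' A A' -
        ampV (pic325c hn2) (cwLeg 0) (cwLeg 1) η (fun xs μ μ' => c325c τ Gj'' (xs (cwLeg 0).1) μ μ') g g' A A' -
      ampV (pic325d hn2) (dwLeg 0) (dwLeg 1) η (fun xs μ μ' => c325d η τ Gj'' (xs (dwLeg 0).1) μ μ') g g' A A' =
    (∑ x : Site P j, η ^ P.d * ∑ μ : Fin P.d, ∑ μ' : Fin P.d,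
        g x * A ⟨x, μ⟩ * Pi2 η τ Gj Gj' Gj'' μ μ' x * (g' x * A' ⟨x, μ'⟩)) +
      (∑ ν : Fin P.d, ∑ x : Site P j, η ^ P.d * ∑ μ : Fin P.d, ∑ μ' : Fin P.d,
        g x * A ⟨x, μ⟩ * Pi3 η τ Gj Gj' dx μ μ' ν x * D ν μ' x) +
    (-ampLeg (blob325a hn).blob (vLeg 0) (vLeg 1) η (kernelV2 (kerA η τ Gj Gj')) g A R +
      ampLeg (blob325b hn).blob (vLeg 0) (vLeg 1) η (kernelV2 (kerB η τ Gj Gj')) g A R) := by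
  rw [← lhs326_eq_pics, ← bracket326_eq_Pi2, ← curly1_eq_Pi3, ← curly2_eq_pics]
  exact eq326 η τ Gj Gj' Gj'' g g' A A' dx D R hT

end

end Dictionary

/-! ## v1.1 (append-only): the local vertices of (3.30)/(3.32) as DOTS (p26 g35's `B3Eq317Pictures.DotPicture`, one dot vocabulary) -/

section Dots

open B3Prop1 B3Sect2Statements B3Cor23Concrete B3Eq37Pictures B3Eq332Pictures B3Eq317Pictures
open LatticeFieldCalculus B3Sect3ScalarSelfEnergy B3Sect3VectorSelfEnergy

/-- **The vertex ∿∗∿ of (3.30) (and ∿×∿ of (3.32)) drawn as a dot**: no scalar leg, two wavy legs, no arrowhead, no internal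
line (p26's `DotPicture`); its coefficient is Π_{μμ′}(x) (r15's `Pi2`; *"proportional to (L^{j₀}η)^{−d+2}"*).
[cite: Balaban1983Higgs3, (3.30) p.442] -/
def dot330 : DotPicture := ⟨0, 2, ![], ![0, 0]⟩

/-- **The vertex ∿∗→∿ of (3.30) drawn as a dot**: two wavy legs, ONE arrowhead on the second (the leg (∂^η_νg′A′_{μ′})(x)); its
coefficient is Π_{μμ′ν}(x) (r15's `Pi3`; *"bounded"*). [cite: Balaban1983Higgs3, (3.30) p.442] -/
def dot330d : DotPicture := ⟨0, 2, ![], ![0, 1]⟩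

/-- The counts of the two dots (p26's `DotPicture.counts`): η^d, no scalar leg, two vector legs, 0 resp. 1 differentiation.
[cite: Balaban1983Higgs3, (2.1) p.422] -/
theorem dot330_counts (d : ℕ) :
    dot330.counts d = ⟨d, 0, 2, 0, false⟩ ∧ dot330d.counts d = ⟨d, 0, 2, 1, false⟩ := by
  constructor
  · show (⟨(d : ℤ), 0, 2, (∑ i : Fin 0, (![] : Fin 0 → ℕ) i) + ∑ i : Fin 2, (![0, 0] : Fin 2 → ℕ) i, false⟩ : VertexCounts) = _
    simp [Fin.sum_univ_two]
  · show (⟨(d : ℤ), 0, 2, (∑ i : Fin 0, (![] : Fin 0 → ℕ) i) + ∑ i : Fin 2, (![0, 1] : Fin 2 → ℕ) i, false⟩ : VertexCounts) = _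
    simp [Fin.sum_univ_two]

/-- D(v) of the two dots in r15's vertex count (2.1)/p. 423 (`degree`): `d + 2·(2−d)/2 = 2` for ∿∗∿ and `2 − 1 = 1` for ∿∗→∿,
in every dimension (the printed sizes of their COEFFICIENTS are the analytic cells, not this count).
[cite: Balaban1983Higgs3, (2.1) p.422] -/
theorem degree_dot330 (d : ℕ) : degree d (dot330.counts d) = 2 ∧ degree d (dot330d.counts d) = 1 := by
  rw [(dot330_counts d).1, (dot330_counts d).2, degree_eq, degree_eq]
  constructor
  · simp; ring
  · simp; ring

noncomputable section

variable {nbar : ℕ} {P : Params} {j : ℕ}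

/-- **The expression of the dot ∿∗∿** with a coefficient c_{μμ′}(x): Σ_xη^dΣ_{μμ′} g(x)A_μ(x)·c_{μμ′}(x)·F_{μ′}(x), both wavy legs
at the point x (F_{μ′} = g′A′_{μ′}: the square bracket of (3.26) with c = Π_{μμ′}, the second term of (3.31) with c = Σ_{x′}η^dΠ_{μμ′}
(x,x′)). [cite: Balaban1983Higgs3, (3.30) p.442] -/
def amp330 (η : ℝ) (c : Site P j → Fin P.d → Fin P.d → ℝ) (g : SiteField P j ℝ) (A : VecField P j ℝ)
    (Fl : Fin P.d → SiteField P j ℝ) : ℝ :=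
  ∑ x : Site P j, η ^ P.d * ∑ μ : Fin P.d, ∑ μ' : Fin P.d, g x * A ⟨x, μ⟩ * c x μ μ' * Fl μ' x

/-- **The expression of the dot ∿∗→∿** with a coefficient c_{μμ′ν}(x): Σ_νΣ_xη^dΣ_{μμ′} g(x)A_μ(x)·c_{μμ′ν}(x)·D_{νμ′}(x), the arrowed
leg D_{νμ′} = ∂^η_ν(g′A′_{μ′}) at the point x, the direction ν of the arrow summed (the first curly bracket of (3.26) with c =
Π_{μμ′ν}). [cite: Balaban1983Higgs3, (3.30) p.442] -/
def amp330d (η : ℝ) (c : Site P j → Fin P.d → Fin P.d → Fin P.d → ℝ) (g : SiteField P j ℝ) (A : VecField P j ℝ)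
    (D : Fin P.d → Fin P.d → SiteField P j ℝ) : ℝ :=
  ∑ ν : Fin P.d, ∑ x : Site P j, η ^ P.d * ∑ μ : Fin P.d, ∑ μ' : Fin P.d, g x * A ⟨x, μ⟩ * c x μ μ' ν * D ν μ' x

/-- ∿∗∿ with the coefficient Π_{μμ′} IS the square bracket of (3.26) (r15's `bracket326_eq_Pi2`). [cite: Balaban1983Higgs3, (3.30) p.442] -/
theorem bracket326_eq_amp330 (η τ : ℝ) (Gj Gj' Gj'' : Kernel P j) (g g' : SiteField P j ℝ) (A A' : VecField P j ℝ) :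
    bracket326 η τ Gj Gj' Gj'' g g' A A' =
      amp330 η (fun x μ μ' => Pi2 η τ Gj Gj' Gj'' μ μ' x) g A (fun μ' x => g' x * A' ⟨x, μ'⟩) := by
  unfold amp330
  exact bracket326_eq_Pi2 η τ Gj Gj' Gj'' g g' A A'

/-- ∿∗→∿ with the coefficient Π_{μμ′ν} IS the first curly bracket of (3.26) (r15's `curly1_eq_Pi3`). [cite: Balaban1983Higgs3, (3.30) p.442] -/
theorem curly1_eq_amp330d (η τ : ℝ) (Gj Gj' : Kernel P j) (g : SiteField P j ℝ) (A : VecField P j ℝ)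
    (dx : Fin P.d → Site P j → Site P j → ℝ) (D : Fin P.d → Fin P.d → SiteField P j ℝ) :
    curly1 η τ Gj Gj' g A dx D = amp330d η (fun x μ μ' ν => Pi3 η τ Gj Gj' dx μ μ' ν x) g A D := by
  unfold amp330d
  exact curly1_eq_Pi3 η τ Gj Gj' g A dx D

/-- The vertex ∿×∿ of (3.32) for a blob `B` IS the dot ∿∗∿ with the coefficient Σ_{x′}η^dΠ_{μμ′}(x,x′) (`VBlob.vertexCoeff`;
`B3Eq332Pictures.ampV_vertex_resummed`). [cite: Balaban1983Higgs3, (3.32) p.442] -/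
theorem ampV_vertex_eq_amp330 (B : VBlob nbar) (η : ℝ) (K : (Fin B.G.nV → Site P j) → Fin P.d → Fin P.d → ℝ)
    (g g' : SiteField P j ℝ) (A A' : VecField P j ℝ) :
    ampV B.vertex B.e B.e' η K g g' A A' =
      amp330 η (fun x μ μ' => B.vertexCoeff η K μ μ' x) g A (fun μ' x => g' x * A' ⟨x, μ'⟩) := by
  unfold amp330
  exact ampV_vertex_resummed B η K g g' A A'

variable (hn : 1 ≤ nbar) (hn2 : 2 ≤ nbar)

/-- **(3.30) with its two vertices as dots**: under Taylor's formula (3.10) for the leg g′A′_{μ′} (hypothesis `hT` as in r15's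
`eq326`), [−A₁ + A₂ − A₃ − A₄] (the four drawn pictures (3.25)) = [∿∗∿ with Π_{μμ′}] + [∿∗→∿ with Π_{μμ′ν}] + [−H₁ + H₂] (the two
decorated pictures with the remainder leg). [cite: Balaban1983Higgs3, (3.30) p.442] -/
theorem eq330_dot (η τ : ℝ) (Gj Gj' Gj'' : Kernel P j) (g g' : SiteField P j ℝ) (A A' : VecField P j ℝ)
    (dx : Fin P.d → Site P j → Site P j → ℝ) (D : Fin P.d → Fin P.d → SiteField P j ℝ)
    (R : Fin P.d → Site P j → Site P j → ℝ)
    (hT : ∀ (μ' : Fin P.d) (x x' : Site P j),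
      g' x' * A' ⟨x', μ'⟩ = g' x * A' ⟨x, μ'⟩ + (∑ ν : Fin P.d, dx ν x x' * D ν μ' x) + R μ' x x') :
    -ampV (blob325a hn).blob (vLeg 0) (vLeg 1) η (kernelV2 (kerA η τ Gj Gj')) g g' A A' +
          ampV (blob325b hn).blob (vLeg 0) (vLeg 1) η (kernelV2 (kerB η τ Gj Gj')) g g' A A' -
        ampV (pic325c hn2) (cwLeg 0) (cwLeg 1) η (fun xs μ μ' => c325c τ Gj'' (xs (cwLeg 0).1) μ μ') g g' A A' -
      ampV (pic325d hn2) (dwLeg 0) (dwLeg 1) η (fun xs μ μ' => c325d η τ Gj'' (xs (dwLeg 0).1) μ μ') g g' A A' =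
    amp330 η (fun x μ μ' => Pi2 η τ Gj Gj' Gj'' μ μ' x) g A (fun μ' x => g' x * A' ⟨x, μ'⟩) +
      amp330d η (fun x μ μ' ν => Pi3 η τ Gj Gj' dx μ μ' ν x) g A D +
    (-ampLeg (blob325a hn).blob (vLeg 0) (vLeg 1) η (kernelV2 (kerA η τ Gj Gj')) g A R +
      ampLeg (blob325b hn).blob (vLeg 0) (vLeg 1) η (kernelV2 (kerB η τ Gj Gj')) g A R) := by
  rw [← bracket326_eq_amp330, ← curly1_eq_amp330d, ← lhs326_eq_pics, ← curly2_eq_pics]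
  exact eq326 η τ Gj Gj' Gj'' g g' A A' dx D R hT

end

end Dots

end Literature.MathematicalPhysics.QuantumFieldTheory.Balaban1983to89.B3Eq330Pictures
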